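import Literature.AlgebraicGeometry.AbelianSchemes.PoincareFamilyKSAssembly
import Literature.AlgebraicGeometry.Morphisms.ArtinianLiftsOfSmoothEtale
import HarnessLib

/-!
# Kodaira–Spencer INJECTIVITY for the Poincaré family, lift level: an infinitesimal point of `A` whose Mumford class
# vanishes is the unit (Mumford, *Abelian Varieties* §13, proof of the Theorem p. 126: «`Lie K(L) = 0`», with `π : A → Â` étale)

Layer `Literature/AlgebraicGeometry/AbelianSchemes`, namespace `Literature.AlgebraicGeometry.AbelianSchemes.AbelianSchemeOver`.
THEOREMS ONLY (no definition, no named fact, no instance, no notation, no `sorry`).  Universe `0` throughout (as ★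
`PoincareFamilyKSAssembly`, whose §2 this file composes with the universe-polymorphic ★ `ArtinianLiftsOfSmoothEtale`).

Setting: `A, Â` abelian schemes over `S`, `π : A → Â` a homomorphism with `π` ÉTALE and the KERNEL CLAUSE
`u ≫ π = 1 ↔ u ∈ K(L)` on all `T`-points (★ `MemKOfL`), `L` of rank one on `A`; a surjection `q : C′ ↠ C` with nilpotent kernel
(e.g. a principal small extension), `c′ : Spec C′ → S`, the bound morphism `ι₀ : Spec C ↪ Spec C′` over `S`.

* **`eq_one_of_detClassH_mumford_eq_zero`** — an infinitesimal `C′`-point `k` of `A` over `S` (`ι₀ ≫ k = 1`) whose class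
  `[(1 × k)^*Λ(L)] ∈ H¹(A_{C′}, 𝒪^×)` VANISHES is `k = 1`: by ★ `comp_eq_one_of_detClassH_mumford_eq_zero` (the kernel clause) `k`
  is killed by `π`, and `k`, `1` are two lifts through the ÉTALE `π` of the same `C`-point with the same image, hence equal (★
  `Morphisms.Over.eq_of_etale_of_isNilpotent`, [EGAIV4] (17.1.1), [SGA1] I 5.6).  This is the `(hinj)` input of ★
  `exists_lift_detClassH_eq_add_of_count` at the level of points (node S-e of the cell's (Mc) N3′ tower; the passage to the
  parameter `v ∈ κ^g` is the injectivity of ★ `Deformation.exists_lifts_parametrisation`).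
* `eq_one_of_detClassH_mumford_eq_zero_of_smallExtension` — the same with the nilpotency read off a principal small extension
  (`ker q = (t₀)`, `t₀ ∈ 𝔪`, `t₀ · 𝔪 = 0`; `C′` local), the binders of the N3′ letters.
* `eq_one_of_detClassH_mumford_eq_truncExp_zero` — the class-level form: if `[(1 × k)^*Λ(L)] = exp(t)` and `t = 0` then `k = 1`.

Cell hodgecm-mathlib (D-0151), (Mc) N3′ line `Cruxes/HDel/Lines/F3DualAbelianSchemeMcN3.lean`, letter S-e, brick K1 (lead B-p02 (g17)
22:04:13Z; wave-1 prover F0P1c-p04 for the integrator F0P1c-p01).  HC_CM is proved only modulo the 7 printed citations until rung 0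
closes; this file discharges none of them (count-neutral capital).

## References
* [MumfordAV1970] D. Mumford, *Abelian Varieties* (1970), §13, proof of the Theorem, p. 126 («since `K(L)` is finite, `Lie K(L) = 0`,
  so the map on tangent spaces is injective»).
* [EGAIV4] A. Grothendieck, *Éléments de géométrie algébrique* IV₄, Publ. Math. IHÉS 32 (1967), Déf. (17.1.1), Déf. (17.3.1).
* [SGA1] A. Grothendieck, M. Raynaud, *Revêtements étales et groupe fondamental (SGA 1)*, LNM 224 (1971), Exp. I Cor. 5.6.
* [Hartshorne2010] R. Hartshorne, *Deformation Theory* (2010), §6 (small extensions, p. 50).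
-/

set_option autoImplicit false

noncomputable section

-- `TopCat.Presheaf`/`Scheme.Modules` are not reducible (as in ★ `AbelianSchemeKOfL`).
set_option backward.isDefEq.respectTransparency false

open CategoryTheory CategoryTheory.Limits AlgebraicGeometry MonoidalCategory CartesianMonoidalCategory
open scoped MonObj

namespace Literature.AlgebraicGeometry.AbelianSchemes

open Literature.AlgebraicGeometry.Motives Literature.AlgebraicGeometry.Modules Literature.AlgebraicGeometry.Deformation
  Literature.AlgebraicGeometry.Morphisms

namespace AbelianSchemeOver

variable {S : Scheme.{0}} (A hat : AbelianSchemeOver S) (π : A.X ⟶ hat.X) [IsMonHom π] [Etale π.left]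
  {L : A.left.Modules} (hL : HasRank L 1)
  (hker : ∀ (T : Over S) (u : T ⟶ A.X), u ≫ π = 1 ↔ A.MemKOfL L u)
  {C' C : Type} [CommRing C'] [CommRing C] (q : C' →+* C) (hq : Function.Surjective q)
  (c' : Spec (.of C') ⟶ S)
  (ι₀ : Over.mk (Spec.map (CommRingCat.ofHom q) ≫ c') ⟶ Over.mk c') (hι : ι₀.left = Spec.map (CommRingCat.ofHom q))

include hker hq hι in
/-- **KODAIRA–SPENCER INJECTIVITY, LIFT LEVEL** ([MumfordAV1970] §13 p. 126 «`Lie K(L) = 0`»): for `π : A → Â` an ÉTALE homomorphism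
with kernel `K(L)` on points, a nilpotent thickening `Spec C ↪ Spec C′` over `S`, and an infinitesimal `C′`-point `k` of `A`
(`ι₀ ≫ k = 1`) whose Mumford class `[(1 × k)^*Λ(L)]` vanishes in `H¹(A_{C′}, 𝒪^×)`, one has `k = 1` — `π` kills `k` (★
`comp_eq_one_of_detClassH_mumford_eq_zero`), and lifts through an étale morphism are unique (★ `Over.eq_of_etale_of_isNilpotent`).
[cite: MumfordAV1970, §13 (proof of the Theorem, p. 126)] [cite: EGAIV4, Déf. (17.1.1) and Déf. (17.3.1)] [cite: SGA1, Exp. I Cor. 5.6] -/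
theorem eq_one_of_detClassH_mumford_eq_zero (hnil : IsNilpotent (RingHom.ker q)) (k : Over.mk c' ⟶ A.X) (hk : ι₀ ≫ k = 1)
    (h : detClassH (HasRank.isFiniteLocallyFree' (hasRank_pullback (A.X ◁ k).left (A.hasRank_mumfordBundle hL))) = 0) :
    k = 1 := by
  have hπk : k ≫ π = 1 := A.comp_eq_one_of_detClassH_mumford_eq_zero hat π hL hker k h
  exact Over.eq_of_etale_of_isNilpotent π q hq hnil c' ι₀ hι k 1 (by rw [hk, MonObj.comp_one])
    (by rw [hπk, MonObj.one_comp])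

include hker hq hι in
/-- **The same along a PRINCIPAL SMALL EXTENSION of a local ring** (`ker q = (t₀)`, `t₀ ∈ 𝔪`, `t₀ · 𝔪 = 0` ⇒ `(ker q)² = 0`): the
binders of the (Mc) N3′ letters. [cite: MumfordAV1970, §13 (proof of the Theorem, p. 126)] [cite: Hartshorne2010, §6 (p. 50)] -/
theorem eq_one_of_detClassH_mumford_eq_zero_of_smallExtension [IsLocalRing C'] (t₀ : C')
    (hker₀ : RingHom.ker q = Ideal.span {t₀}) (htm : ∀ m ∈ IsLocalRing.maximalIdeal C', t₀ * m = 0)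
    (ht₀m : t₀ ∈ IsLocalRing.maximalIdeal C') (k : Over.mk c' ⟶ A.X) (hk : ι₀ ≫ k = 1)
    (h : detClassH (HasRank.isFiniteLocallyFree' (hasRank_pullback (A.X ◁ k).left (A.hasRank_mumfordBundle hL))) = 0) :
    k = 1 := by
  have hsq : RingHom.ker q ^ 2 = ⊥ := by
    rw [hker₀, Ideal.span_singleton_pow, Ideal.span_singleton_eq_bot, pow_two]
    exact htm t₀ ht₀m
  exact A.eq_one_of_detClassH_mumford_eq_zero hat π hL hker q hq c' ι₀ hι ⟨2, hsq⟩ k hk h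

include hker hq hι in
/-- **Class-level form**: along a first-order thickening `1_A × ι₀` with ideal `𝓘`, if the Mumford class of the infinitesimal point
`k` is `exp(t)` for `t ∈ H¹(𝓘)` (the shape produced by ★ `PoincareFamilyKSClasses`) and `t = 0`, then `k = 1` — so the parametrised
classes `v ↦ cls v` of ★ `exists_lift_detClassH_eq_add_of_count` satisfy `cls v = 0 → pt v = 1`.
[cite: MumfordAV1970, §13 (proof of the Theorem, p. 126)] [cite: SGA1, Exp. I Cor. 5.6] -/
theorem eq_one_of_detClassH_mumford_eq_truncExp_zero (hnil : IsNilpotent (RingHom.ker q))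
    [IsFirstOrderThickening (A.X ◁ ι₀).left] (k : Over.mk c' ⟶ A.X) (hk : ι₀ ≫ k = 1)
    (t : (idealSheafAb (A.X ◁ ι₀).left).H 1) (ht : t = 0)
    (h : detClassH (HasRank.isFiniteLocallyFree' (hasRank_pullback (A.X ◁ k).left (A.hasRank_mumfordBundle hL))) =
      Sheaf.H.map (truncExp (A.X ◁ ι₀).left) 1 t) :
    k = 1 := by
  subst ht
  rw [map_zero] at h
  exact A.eq_one_of_detClassH_mumford_eq_zero hat π hL hker q hq c' ι₀ hι hnil k hk h

end AbelianSchemeOver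

end Literature.AlgebraicGeometry.AbelianSchemes

end
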